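import Literature.NumberTheory.LFunctions.SiegelExceptionalZeroBound
import HarnessLib

/-!
# The quality `η` of a Siegel zero is `≪_ε q^ε` (Matomäki–Merikoski (1.3))

Topic `Literature/NumberTheory/LFunctions`.  Everything in this file is PROVED (theorems only).

Matomäki–Merikoski (IMRN 2023, arXiv:2112.11412) parametrise a real zero of `L(s, χ)` (`χ` primitive
quadratic mod `q`) as `β₀ = 1 − 1/(η log q)` and record, display (1.3): "By Siegel's theorem we have
(ineffectively) `η ≪_ε q^ε`"; §7 then assumes "`η ≪ q^ε`".  This file derives exactly that from the
tree's PROVED form of Siegel's theorem for real zeros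
(`Siegel.exists_one_sub_realZero_ge`: `C(ε) q^{−ε} ≤ 1 − β` for every real zero `β` of a quadratic
`χ ≠ χ₀`, Montgomery–Vaughan Cor. 11.15):

* `SiegelZeroQuality.eta_le_mul_rpow` — for every `ε > 0` there is `C > 0` with `η ≤ C q^ε` whenever
  `L(1 − 1/(η log q), χ) = 0`, `η > 0`, `χ` primitive quadratic mod `q ≥ 2`;
* `SiegelZeroQuality.exists_eta_le_level` — there is `η₁` such that `η ≥ η₁` forces `η ≤ q`
  (the case `ε = 1/2`: `η ≤ C√q`, and `η ≥ η₁ = C² + 1` forces `√q ≥ C`).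

(Ineffective, as Siegel's theorem.  The elementary effective bound `1 − β ≫ q^{-1/2}(log q)^{-2}` would
give `η ≪ √q log q` and serve the same purpose, but is not needed here.)

## References

* K. Matomäki, J. Merikoski, IMRN 2023 (arXiv:2112.11412), (1.3) and §7 (first paragraph).
  [cite: MatomakiMerikoski2023, (1.3)]
* H. L. Montgomery, R. C. Vaughan, *Multiplicative Number Theory I*, Corollary 11.15.
  [MontgomeryVaughan2007]
-/

noncomputable section

open Real

namespace Literature.NumberTheory.LFunctions

namespace SiegelZeroQuality

/-- A primitive character of level `q ≥ 2` is not the trivial character (whose conductor is `1`).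
[folklore] -/
theorem ne_one_of_isPrimitive {q : ℕ} [NeZero q] {χ : DirichletCharacter ℂ q} (hprim : χ.IsPrimitive)
    (hq : 2 ≤ q) : χ ≠ 1 := by
  rintro rfl
  rw [DirichletCharacter.isPrimitive_def, DirichletCharacter.conductor_one] at hprim
  omega

/-- **Matomäki–Merikoski (1.3): `η ≪_ε q^ε`.**  For every `ε > 0` there is `C > 0` such that for every
primitive quadratic `χ` mod `q ≥ 2` and every `η > 0` with `L(1 − 1/(η log q), χ) = 0` one has
`η ≤ C q^ε` (Siegel: `C(ε) q^{−ε} ≤ 1 − β₀ = 1/(η log q)`, and `log q ≥ log 2`).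
[cite: MatomakiMerikoski2023, (1.3)] -/
theorem eta_le_mul_rpow {ε : ℝ} (hε : 0 < ε) :
    ∃ C : ℝ, 0 < C ∧ ∀ (q : ℕ) [NeZero q] (χ : DirichletCharacter ℂ q), χ.IsPrimitive → χ.IsQuadratic →
      2 ≤ q → ∀ η : ℝ, 0 < η → χ.LFunction ((1 - 1 / (η * Real.log q) : ℝ) : ℂ) = 0 →
        η ≤ C * (q : ℝ) ^ ε := by
  obtain ⟨C₁, hC₁, H⟩ := Siegel.exists_one_sub_realZero_ge hε
  refine ⟨1 / (C₁ * Real.log 2), by positivity, ?_⟩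
  intro q _ χ hprim hquad hq η hη hL
  have hq2 : (2 : ℝ) ≤ q := by exact_mod_cast hq
  have hq0 : (0 : ℝ) < q := by linarith
  have hlogq : Real.log 2 ≤ Real.log q := Real.log_le_log two_pos hq2
  have hlog2 : 0 < Real.log 2 := Real.log_pos one_lt_two
  have hlogq0 : 0 < Real.log q := by linarith
  have hsq : χ ^ 2 = 1 := MulChar.isQuadratic_iff_sq_eq_one.mp hquad
  have hne : χ ≠ 1 := ne_one_of_isPrimitive hprim hq
  have hβ := H q χ hsq hne (1 - 1 / (η * Real.log q)) hL
  -- `C₁ q^{-ε} ≤ 1/(η log q)`, i.e. `η ≤ q^ε/(C₁ log q)`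
  have h1 : C₁ * (q : ℝ) ^ (-ε) ≤ 1 / (η * Real.log q) := by linarith
  have hqε : 0 < (q : ℝ) ^ ε := Real.rpow_pos_of_pos hq0 ε
  have h2 : (q : ℝ) ^ (-ε) = 1 / (q : ℝ) ^ ε := by rw [Real.rpow_neg hq0.le, one_div]
  rw [h2] at h1
  have h3 : η * Real.log q * C₁ ≤ (q : ℝ) ^ ε := by
    have := mul_le_mul_of_nonneg_left h1 (show 0 ≤ η * Real.log q * (q : ℝ) ^ ε by positivity)
    have e1 : η * Real.log q * (q : ℝ) ^ ε * (C₁ * (1 / (q : ℝ) ^ ε)) = η * Real.log q * C₁ := by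
      field_simp
    have e2 : η * Real.log q * (q : ℝ) ^ ε * (1 / (η * Real.log q)) = (q : ℝ) ^ ε := by
      field_simp
    rw [e1, e2] at this
    exact this
  calc η = η * Real.log q * C₁ / (C₁ * Real.log q) := by field_simp
    _ ≤ (q : ℝ) ^ ε / (C₁ * Real.log q) := div_le_div_of_nonneg_right h3 (by positivity)
    _ ≤ (q : ℝ) ^ ε / (C₁ * Real.log 2) := by
        refine div_le_div_of_nonneg_left hqε.le (by positivity) ?_
        exact mul_le_mul_of_nonneg_left hlogq hC₁.le
    _ = 1 / (C₁ * Real.log 2) * (q : ℝ) ^ ε := by ring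

/-- **Large quality forces a large level: `η ≥ η₁ ⇒ η ≤ q`.**  There is `η₁ > 0` such that every
primitive quadratic `χ` mod `q ≥ 2` with `L(1 − 1/(η log q), χ) = 0` and `η ≥ η₁` has `η ≤ q`
(from `eta_le_mul_rpow` with `ε = 1/2`: `η ≤ C√q`; if `η ≥ C² + 1` then `√q > C`, so `C√q ≤ q`).
This is the form in which "`η ≪ q^ε`" enters §7 of the source (`log q ≥ log η` in `z = q^{V/u}`).
[cite: MatomakiMerikoski2023, (1.3) and §7] -/
theorem exists_eta_le_level :
    ∃ η₁ : ℝ, 0 < η₁ ∧ ∀ (q : ℕ) [NeZero q] (χ : DirichletCharacter ℂ q), χ.IsPrimitive → χ.IsQuadratic →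
      2 ≤ q → ∀ η : ℝ, η₁ ≤ η → χ.LFunction ((1 - 1 / (η * Real.log q) : ℝ) : ℂ) = 0 → η ≤ q := by
  obtain ⟨C, hC, H⟩ := eta_le_mul_rpow (show (0 : ℝ) < 1 / 2 by norm_num)
  refine ⟨C ^ 2 + 1, by positivity, ?_⟩
  intro q _ χ hprim hquad hq η hη hL
  have hη0 : 0 < η := by nlinarith
  have hq0 : (0 : ℝ) < q := by exact_mod_cast (show 0 < q by omega)
  have h1 := H q χ hprim hquad hq η hη0 hL
  rw [← Real.sqrt_eq_rpow] at h1
  have hsq : Real.sqrt q * Real.sqrt q = q := Real.mul_self_sqrt hq0.le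
  have hs0 : 0 ≤ Real.sqrt q := Real.sqrt_nonneg _
  -- `C < √q`: otherwise `η ≤ C √q ≤ C²`, contradicting `η ≥ C² + 1`
  have hCs : C ≤ Real.sqrt q := by
    by_contra hlt
    push Not at hlt
    have : η ≤ C * C := h1.trans (mul_le_mul_of_nonneg_left hlt.le hC.le)
    nlinarith
  calc η ≤ C * Real.sqrt q := h1
    _ ≤ Real.sqrt q * Real.sqrt q := mul_le_mul_of_nonneg_right hCs hs0
    _ = q := hsq

/-- **`η ≫_ε 1 ⇒ log η ≤ ε log q`** (the logarithmic form of "`η ≪ q^ε`" used in the bookkeeping of §7: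
with `u ≤ log η` one needs `log q ≥ ε⁻¹ log η`).  For every `ε > 0` there is `η₀ > 0` such that every primitive
quadratic `χ` mod `q ≥ 2` with `L(1 − 1/(η log q), χ) = 0` and `η ≥ η₀` has `log η ≤ ε log q`
(`eta_le_mul_rpow` with `ε/2`: `η ≤ C q^{ε/2}`; for `η ≥ C² + 1` this forces `log C ≤ (ε/2) log q`).
[cite: MatomakiMerikoski2023, (1.3) and §7] -/
theorem exists_log_eta_le_mul_log {ε : ℝ} (hε : 0 < ε) :
    ∃ η₀ : ℝ, 0 < η₀ ∧ ∀ (q : ℕ) [NeZero q] (χ : DirichletCharacter ℂ q), χ.IsPrimitive → χ.IsQuadratic →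
      2 ≤ q → ∀ η : ℝ, η₀ ≤ η → χ.LFunction ((1 - 1 / (η * Real.log q) : ℝ) : ℂ) = 0 →
        Real.log η ≤ ε * Real.log q := by
  obtain ⟨C, hC, H⟩ := eta_le_mul_rpow (half_pos hε)
  refine ⟨C ^ 2 + 1, by positivity, ?_⟩
  intro q _ χ hprim hquad hq η hη hL
  have hη0 : 0 < η := by nlinarith
  have hq2 : (2 : ℝ) ≤ q := by exact_mod_cast hq
  have hq0 : (0 : ℝ) < q := by linarith
  have hlogq : 0 ≤ Real.log q := Real.log_nonneg (by linarith)
  have h1 := H q χ hprim hquad hq η hη0 hL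
  have hpow : 0 < (q : ℝ) ^ (ε / 2) := Real.rpow_pos_of_pos hq0 _
  -- `log η ≤ log C + (ε/2) log q`
  have h2 : Real.log η ≤ Real.log C + ε / 2 * Real.log q := by
    have := Real.log_le_log hη0 h1
    rwa [Real.log_mul hC.ne' hpow.ne', Real.log_rpow hq0] at this
  -- `η ≥ C² + 1 > C²` gives `2 log C < log η`, hence `log C ≤ (ε/2) log q`
  have h3 : 2 * Real.log C < Real.log η := by
    have hC2 : C ^ 2 < η := by linarith
    have := Real.log_lt_log (by positivity) hC2
    rwa [Real.log_pow, Nat.cast_ofNat] at this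
  have h4 : Real.log C ≤ ε / 2 * Real.log q := by linarith
  linarith

end SiegelZeroQuality

end Literature.NumberTheory.LFunctions
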